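import Summits.QuantumFields.YangMills.Theorems.VirialFluxGapResolventFieldPointwise
import Summits.QuantumFields.YangMills.Theorems.VirialFluxGapResolventFieldCalculus
import HarnessLib

/-!
# Route `VirialFluxGap` (YangMills): the RESOLVENT EULER FIELD — its COEFFICIENT FUNCTIONS are smooth functions of the coordinates

Toward the deciding crux `VirialFluxGap.PeriodicSoftness` (item stmt-QuantumFields-24141), generic-region Euler field `X_g = ½(H+λ⋆)⁻¹g`
(memo v2 `fcl-p3-g40-RESOLVENT-EULER-FIELD-24141-v2.md`, assembly step (A)).  The «EulerField» hypothesis of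
✓`EulerFieldReduction.periodicSoftness_of_eulerField` needs, for every coefficient `φ_j`, differentiability along the frame curves at EVERY
parameter, boundedness and measurability; by w3's ✓`FrameDerivative.hasDerivAt_comp_ringCoord_sliceCurve` ∕ ✓`regular_comp_ringCoord` all of
this follows once `φ_j = Φ_j ∘ ringCoord` with `Φ_j` a SMOOTH function of the ambient coordinates.  This file proves that smoothness for the
cut-off resolvent coefficients

  `resolventCoeff τ λ⋆ χ j M := χ(M) · ½ · ((frameHess τ M + λ⋆·1)⁻¹ · frameGrad τ M)_j`

for any smooth cut-off `χ` whose topological support lies in the open set where `frameHess τ M + λ⋆·1` is invertible: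

* §1 `contDiff_det_of_entries` ∕ `contDiff_adjugate_of_entries` ∕ `contDiffOn_inv_entry_of_entries` — determinant, adjugate and (on `{det ≠ 0}`)
  inverse entries of an entrywise-smooth matrix function are smooth; `contDiff_mul_of_tsupport_subset` — `χ·f` is smooth when `f` is smooth on an
  open set containing `tsupport χ`;
* §2 `contDiff_frameGrad` ∕ `contDiff_frameHess` (iterated ✓`contDiff_frameD`), ★★ `contDiff_resolventCoeff`.

HONEST FRAMING: plumbing; the divergence value of these coefficients along the frame (= ✓`sum_deriv_resolvent_coeff`), the choice of `χ`, the
central charts and the assembly are NOT here; ⟨24141⟩ stays OPEN; no stub / crux / rung / summit is closed; the Yang–Mills mass gap is NOT proved;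
no summit is proved by a line.  One definition (`resolventCoeff`, problem-side plumbing, no `Prop`); 0 `sorry`, standard axioms.  Explicit-unit
seat `ym-line-fcl-p3` g40 (cell ym-idea-1, free hands), `--supports stmt-QuantumFields-24141`.  References: [folklore].
-/

set_option autoImplicit false

noncomputable section

open scoped Matrix BigOperators ContDiff Topology
open MeasureTheory Set Matrix
open Literature.MathematicalPhysics.QuantumFieldTheory hiding SU2
open Literature.MathematicalPhysics.QuantumLattice
open Literature.MathematicalPhysics.QuantumFieldTheory.SUNBakryEmery (expSU coe_expSU matTop)

namespace Summit.QuantumFields.YangMills.Theorems.VirialFluxGap.FrameHessian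

open Summit.QuantumFields.YangMills.Theorems.FemtoTransferGap
open Summit.QuantumFields.YangMills.Theorems.FemtoTransferGap.TT
open Summit.QuantumFields.YangMills.Theorems.VirialFluxGap.RingDeficit
open Summit.QuantumFields.YangMills.Theorems.VirialFluxGap.FrameDerivative

/-! ## §1 Smooth matrix functions: determinant, adjugate, inverse entries; cut-off products -/

section MatrixSmooth

variable {X : Type*} [NormedAddCommGroup X] [NormedSpace ℝ X] {ι : Type*} [Fintype ι] [DecidableEq ι]

/-- The determinant of an entrywise-smooth matrix function is smooth. [folklore] -/
theorem contDiff_det_of_entries {A : X → Matrix ι ι ℝ} (hA : ∀ j k, ContDiff ℝ ∞ fun x => A x j k) :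
    ContDiff ℝ ∞ fun x => (A x).det := by
  have h : (fun x => (A x).det) = fun x => ∑ σ : Equiv.Perm ι, ((Equiv.Perm.sign σ : ℤ) : ℝ) * ∏ i, A x (σ i) i := by
    funext x; rw [Matrix.det_apply']
  rw [h]
  refine ContDiff.sum fun σ _ => contDiff_const.mul ?_
  exact contDiff_prod fun i _ => hA (σ i) i

/-- The adjugate of an entrywise-smooth matrix function is entrywise smooth. [folklore] -/
theorem contDiff_adjugate_of_entries {A : X → Matrix ι ι ℝ} (hA : ∀ j k, ContDiff ℝ ∞ fun x => A x j k) (j k : ι) :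
    ContDiff ℝ ∞ fun x => (A x).adjugate j k := by
  have h : (fun x => (A x).adjugate j k) = fun x => ((A x).updateRow k (Pi.single j 1)).det := by
    funext x; rw [Matrix.adjugate_apply]
  rw [h]
  refine contDiff_det_of_entries (A := fun x => (A x).updateRow k (Pi.single j 1)) fun r c => ?_
  by_cases hr : r = k
  · subst hr
    simp only [Matrix.updateRow_self]
    exact contDiff_const
  · simp only [Matrix.updateRow_ne hr]
    exact hA r c

/-- On the open set where the determinant does not vanish, the inverse entries of an entrywise-smooth matrix function are smooth.
[folklore] -/
theorem contDiffOn_inv_entry_of_entries {A : X → Matrix ι ι ℝ} (hA : ∀ j k, ContDiff ℝ ∞ fun x => A x j k) (j k : ι) :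
    ContDiffOn ℝ ∞ (fun x => (A x)⁻¹ j k) {x | (A x).det ≠ 0} := by
  have h : (fun x => (A x)⁻¹ j k) = fun x => ((A x).det)⁻¹ * (A x).adjugate j k := by
    funext x
    rw [Matrix.inv_def, Ring.inverse_eq_inv', Matrix.smul_apply, smul_eq_mul]
  rw [h]
  exact ((contDiff_det_of_entries hA).contDiffOn.inv fun x hx => hx).mul (contDiff_adjugate_of_entries hA j k).contDiffOn

/-- The set where the determinant of an entrywise-smooth (hence continuous) matrix function is nonzero is open. [folklore] -/
theorem isOpen_det_ne_zero {A : X → Matrix ι ι ℝ} (hA : ∀ j k, ContDiff ℝ ∞ fun x => A x j k) : IsOpen {x | (A x).det ≠ 0} :=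
  isOpen_ne_fun (contDiff_det_of_entries hA).continuous continuous_const

omit [Fintype ι] [DecidableEq ι] in
/-- A smooth cut-off times a function smooth on an open set containing the cut-off's topological support is smooth everywhere. [folklore] -/
theorem contDiff_mul_of_tsupport_subset {χ f : X → ℝ} (hχ : ContDiff ℝ ∞ χ) {U : Set X} (hU : IsOpen U) (hf : ContDiffOn ℝ ∞ f U)
    (hsupp : tsupport χ ⊆ U) : ContDiff ℝ ∞ fun x => χ x * f x := by
  rw [contDiff_iff_contDiffAt]
  intro x
  by_cases hx : x ∈ U
  · exact hχ.contDiffAt.mul (hf.contDiffAt (hU.mem_nhds hx))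
  · -- outside `U`, hence outside `tsupport χ`: `χ f = 0` near `x`
    have hx' : x ∉ tsupport χ := fun h => hx (hsupp h)
    have hev : (fun y => χ y * f y) =ᶠ[𝓝 x] fun _ => 0 := by
      have h0 : χ =ᶠ[𝓝 x] 0 := notMem_tsupport_iff_eventuallyEq.1 hx'
      filter_upwards [h0] with y hy
      rw [hy, Pi.zero_apply, zero_mul]
    exact (contDiffAt_const.congr_of_eventuallyEq hev)

end MatrixSmooth

/-! ## §2 The cut-off resolvent coefficients are smooth functions of the coordinates -/

variable {L : ℕ} [NeZero L]
variable {ι : Type*} [Fintype ι] [DecidableEq ι]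

open scoped Matrix.Norms.Frobenius

attribute [local instance 2000] Literature.MathematicalPhysics.QuantumFieldTheory.SUNBakryEmery.matTop

/-- The CUT-OFF RESOLVENT COEFFICIENTS `χ(M)·½·((H(M) + λ⋆)⁻¹ g(M))_j` of the generic-region Euler field, as functions of the ambient
coordinates (junk where the shifted Hessian is singular — the cut-off vanishes there). [folklore] -/
def resolventCoeff (τ : ι → ((Fin (2 * L - 1 + 1) × Edge 3 L) ⊕ Site 3 L) → Matrix (Fin 2) (Fin 2) ℂ) (lam : ℝ) (χ : ((Fin (2 * L - 1 + 1) → Edge 3 L → Matrix (Fin 2) (Fin 2) ℂ) × (Site 3 L → Matrix (Fin 2) (Fin 2) ℂ)) → ℝ) (j : ι) (M : ((Fin (2 * L - 1 + 1) → Edge 3 L → Matrix (Fin 2) (Fin 2) ℂ) × (Site 3 L → Matrix (Fin 2) (Fin 2) ℂ))) : ℝ :=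
  χ M * ((1 / 2) * (((frameHess (L := L) τ M + lam • (1 : Matrix ι ι ℝ))⁻¹ *ᵥ frameGrad (L := L) τ M) j))

omit [Fintype ι] [DecidableEq ι] in
/-- The frame gradient entries are smooth functions of the coordinates. [folklore] -/
theorem contDiff_frameGrad (τ : ι → ((Fin (2 * L - 1 + 1) × Edge 3 L) ⊕ Site 3 L) → Matrix (Fin 2) (Fin 2) ℂ) (j : ι) : ContDiff ℝ ∞ fun M : ((Fin (2 * L - 1 + 1) → Edge 3 L → Matrix (Fin 2) (Fin 2) ℂ) × (Site 3 L → Matrix (Fin 2) (Fin 2) ℂ)) => frameGrad (L := L) τ M j :=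
  contDiff_frameD (contDiff_ringPoly (L := L)) (τ j)

omit [Fintype ι] [DecidableEq ι] in
/-- The raw frame Hessian entries are smooth functions of the coordinates. [folklore] -/
theorem contDiff_frameHessRaw (τ : ι → ((Fin (2 * L - 1 + 1) × Edge 3 L) ⊕ Site 3 L) → Matrix (Fin 2) (Fin 2) ℂ) (j k : ι) :
    ContDiff ℝ ∞ fun M : ((Fin (2 * L - 1 + 1) → Edge 3 L → Matrix (Fin 2) (Fin 2) ℂ) × (Site 3 L → Matrix (Fin 2) (Fin 2) ℂ)) => frameHessRaw (L := L) τ M j k :=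
  contDiff_frameD (contDiff_frameD (contDiff_ringPoly (L := L)) (τ k)) (τ j)

omit [Fintype ι] [DecidableEq ι] in
/-- The symmetrised frame Hessian entries are smooth functions of the coordinates. [folklore] -/
theorem contDiff_frameHess (τ : ι → ((Fin (2 * L - 1 + 1) × Edge 3 L) ⊕ Site 3 L) → Matrix (Fin 2) (Fin 2) ℂ) (j k : ι) :
    ContDiff ℝ ∞ fun M : ((Fin (2 * L - 1 + 1) → Edge 3 L → Matrix (Fin 2) (Fin 2) ℂ) × (Site 3 L → Matrix (Fin 2) (Fin 2) ℂ)) => frameHess (L := L) τ M j k := by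
  unfold frameHess
  exact contDiff_const.mul ((contDiff_frameHessRaw τ j k).add (contDiff_frameHessRaw τ k j))

omit [Fintype ι] in
/-- The shifted Hessian entries are smooth. [folklore] -/
theorem contDiff_shiftedHess (τ : ι → ((Fin (2 * L - 1 + 1) × Edge 3 L) ⊕ Site 3 L) → Matrix (Fin 2) (Fin 2) ℂ) (lam : ℝ) (j k : ι) :
    ContDiff ℝ ∞ fun M : ((Fin (2 * L - 1 + 1) → Edge 3 L → Matrix (Fin 2) (Fin 2) ℂ) × (Site 3 L → Matrix (Fin 2) (Fin 2) ℂ)) => (frameHess (L := L) τ M + lam • (1 : Matrix ι ι ℝ)) j k := by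
  have h : (fun M : ((Fin (2 * L - 1 + 1) → Edge 3 L → Matrix (Fin 2) (Fin 2) ℂ) × (Site 3 L → Matrix (Fin 2) (Fin 2) ℂ)) => (frameHess (L := L) τ M + lam • (1 : Matrix ι ι ℝ)) j k) =
      fun M => frameHess (L := L) τ M j k + lam * (1 : Matrix ι ι ℝ) j k := by
    funext M; simp [Matrix.add_apply, Matrix.smul_apply]
  rw [h]
  exact (contDiff_frameHess τ j k).add contDiff_const

/-- ★★ **The cut-off resolvent coefficients are smooth functions of the coordinates** whenever the smooth cut-off `χ` has topological support
inside the (open) set where `frameHess + λ⋆·1` is invertible. [folklore] -/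
theorem contDiff_resolventCoeff (τ : ι → ((Fin (2 * L - 1 + 1) × Edge 3 L) ⊕ Site 3 L) → Matrix (Fin 2) (Fin 2) ℂ) (lam : ℝ) {χ : ((Fin (2 * L - 1 + 1) → Edge 3 L → Matrix (Fin 2) (Fin 2) ℂ) × (Site 3 L → Matrix (Fin 2) (Fin 2) ℂ)) → ℝ} (hχ : ContDiff ℝ ∞ χ)
    (hsupp : tsupport χ ⊆ {M : ((Fin (2 * L - 1 + 1) → Edge 3 L → Matrix (Fin 2) (Fin 2) ℂ) × (Site 3 L → Matrix (Fin 2) (Fin 2) ℂ)) | (frameHess (L := L) τ M + lam • (1 : Matrix ι ι ℝ)).det ≠ 0}) (j : ι) :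
    ContDiff ℝ ∞ (resolventCoeff (L := L) τ lam χ j) := by
  unfold resolventCoeff
  have hA : ∀ j' k, ContDiff ℝ ∞ fun M : ((Fin (2 * L - 1 + 1) → Edge 3 L → Matrix (Fin 2) (Fin 2) ℂ) × (Site 3 L → Matrix (Fin 2) (Fin 2) ℂ)) => (frameHess (L := L) τ M + lam • (1 : Matrix ι ι ℝ)) j' k := contDiff_shiftedHess τ lam
  have hU : IsOpen {M : ((Fin (2 * L - 1 + 1) → Edge 3 L → Matrix (Fin 2) (Fin 2) ℂ) × (Site 3 L → Matrix (Fin 2) (Fin 2) ℂ)) | (frameHess (L := L) τ M + lam • (1 : Matrix ι ι ℝ)).det ≠ 0} := isOpen_det_ne_zero hA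
  have hinv : ∀ j' k, ContDiffOn ℝ ∞ (fun M : ((Fin (2 * L - 1 + 1) → Edge 3 L → Matrix (Fin 2) (Fin 2) ℂ) × (Site 3 L → Matrix (Fin 2) (Fin 2) ℂ)) => (frameHess (L := L) τ M + lam • (1 : Matrix ι ι ℝ))⁻¹ j' k)
      {M : ((Fin (2 * L - 1 + 1) → Edge 3 L → Matrix (Fin 2) (Fin 2) ℂ) × (Site 3 L → Matrix (Fin 2) (Fin 2) ℂ)) | (frameHess (L := L) τ M + lam • (1 : Matrix ι ι ℝ)).det ≠ 0} := fun j' k => contDiffOn_inv_entry_of_entries hA j' k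
  -- the resolvent applied to the gradient, entry `j`: a finite sum of products
  have hres : ContDiffOn ℝ ∞ (fun M : ((Fin (2 * L - 1 + 1) → Edge 3 L → Matrix (Fin 2) (Fin 2) ℂ) × (Site 3 L → Matrix (Fin 2) (Fin 2) ℂ)) => (1 / 2 : ℝ) *
      (((frameHess (L := L) τ M + lam • (1 : Matrix ι ι ℝ))⁻¹ *ᵥ frameGrad (L := L) τ M) j))
      {M : ((Fin (2 * L - 1 + 1) → Edge 3 L → Matrix (Fin 2) (Fin 2) ℂ) × (Site 3 L → Matrix (Fin 2) (Fin 2) ℂ)) | (frameHess (L := L) τ M + lam • (1 : Matrix ι ι ℝ)).det ≠ 0} := by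
    have h : (fun M : ((Fin (2 * L - 1 + 1) → Edge 3 L → Matrix (Fin 2) (Fin 2) ℂ) × (Site 3 L → Matrix (Fin 2) (Fin 2) ℂ)) => (1 / 2 : ℝ) * (((frameHess (L := L) τ M + lam • (1 : Matrix ι ι ℝ))⁻¹ *ᵥ frameGrad (L := L) τ M) j)) =
        fun M => (1 / 2 : ℝ) * ∑ k, (frameHess (L := L) τ M + lam • (1 : Matrix ι ι ℝ))⁻¹ j k * frameGrad (L := L) τ M k := by
      funext M; rfl
    rw [h]
    refine contDiffOn_const.mul (ContDiffOn.sum fun k _ => (hinv j k).mul (contDiff_frameGrad τ k).contDiffOn)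
  exact contDiff_mul_of_tsupport_subset hχ hU hres hsupp

end Summit.QuantumFields.YangMills.Theorems.VirialFluxGap.FrameHessian

end
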